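import Mathlib.Topology.Order.IntermediateValue
import Mathlib.Topology.Order.Monotone
import Mathlib.Topology.Instances.Real.Lemmas

/-!
# Crux `PerpetualPump.AveragedTypeIBlowup` (stmt-NavierStokesRegularity-1835), line `Sketch`:
# stub `ivtNesting` — nested-interval shooting

This file proves the registered stub `stub_ivtNesting` of the line skeleton
`Cruxes/AveragedTypeIBlowup/Lines/Sketch.lean`, the topological heart of the NESTED-INTERVAL
SHOOTING argument. Data: a sequence of real functions `β k` (the renormalised front amplitude
after `k` cascade steps, as a function of the datum amplitude `A`), a window `[lo, hi]`, `lo < hi`,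
and an initial amplitude interval `[u₀, v₀]` on which `β 0` takes the values `lo` at `u₀`, `hi` at
`v₀` and stays in the window. Hypotheses (the "window one-step theorem"): on the set where
`β 0, …, β k` stay in the window, `β (k+1)` is continuous, and it EXITS the window at the edges
(`β k A = lo ⇒ β (k+1) A < lo`, `β k A = hi ⇒ hi < β (k+1) A`). Conclusion: some amplitude
`A ∈ [u₀, v₀]` has its whole orbit `β k A`, `k ∈ ℕ`, pinned in the window.

Proof (pure real analysis, Mathlib only):
* `ivtNesting_exists_first_eq` / `ivtNesting_exists_last_eq` — for `f` continuous on `[a,b]` with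
  `f a ≤ y ≤ f b`, the FIRST point `c` with `y ≤ f c` (an infimum of a closed set, attained) has
  `f c = y` and `f < y` on `[a,c)`; symmetrically the LAST point with `f c ≤ y` has `f c = y` and
  `y < f` on `(c,b]` (intermediate value theorem + `IsClosed.csInf_mem` / `IsClosed.csSup_mem`).
* `ivtNesting_step` — one nesting step: from an interval `[u,v] ⊆ [u₀,v₀]` on which `β 0..β k`
  stay in the window with `β k u = lo`, `β k v = hi`, produce `u ≤ u' ≤ v' ≤ v` with the same
  property at level `k+1` (first passage of `β (k+1)` through `hi`, then last passage through
  `lo` to its left).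
* `stub_ivtNesting` — iterate the step along `ℕ` (choice functions + `Nat.rec`), obtaining a
  monotone sequence `u k` and an antitone sequence `v k` with `u k ≤ v k`; `A := ⨆ k, u k` lies in
  every `[u k, v k]`, hence `β k A ∈ [lo, hi]` for every `k`.

## References

* T. Tao, *Finite time blowup for an averaged three-dimensional Navier–Stokes equation*, J. Amer.
  Math. Soc. 29 (2016), 601–674, §5 (the shooting / continuity argument is folklore).
-/

noncomputable section

-- the summit namespace `…NavierStokesRegularity.NavierStokesRegularity…` is the tree convention
set_option linter.dupNamespace false

open Set Filter Topology

namespace Summit.NavierStokesRegularity.NavierStokesRegularity.Theorems.PerpetualPumpAveragedTypeIBlowup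

/-- **First passage from below.** If `f` is continuous on `[a,b]` and `f a ≤ y ≤ f b`, then there is
`c ∈ [a,b]` with `f c = y` and `f x < y` for all `x ∈ [a,c)` (namely the infimum of the closed set
`{x ∈ [a,b] | y ≤ f x}`). [folklore] -/
theorem ivtNesting_exists_first_eq {f : ℝ → ℝ} {a b y : ℝ} (hab : a ≤ b)
    (hf : ContinuousOn f (Icc a b)) (ha : f a ≤ y) (hb : y ≤ f b) :
    ∃ c ∈ Icc a b, f c = y ∧ ∀ x ∈ Ico a c, f x < y := by
  set T : Set ℝ := Icc a b ∩ f ⁻¹' (Ici y) with hT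
  have hTc : IsClosed T := hf.preimage_isClosed_of_isClosed isClosed_Icc isClosed_Ici
  have hbT : b ∈ T := ⟨right_mem_Icc.2 hab, hb⟩
  have hTne : T.Nonempty := ⟨b, hbT⟩
  have hTbdd : BddBelow T := ⟨a, fun x hx => hx.1.1⟩
  have hcT : sInf T ∈ T := hTc.csInf_mem hTne hTbdd
  have hcab : sInf T ∈ Icc a b := hcT.1
  have hyc : y ≤ f (sInf T) := hcT.2
  have hleft : ∀ x ∈ Ico a (sInf T), f x < y := by
    intro x hx
    by_contra hxy
    have hxT : x ∈ T := ⟨⟨hx.1, hx.2.le.trans hcab.2⟩, not_lt.1 hxy⟩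
    exact (not_le.2 hx.2) (csInf_le hTbdd hxT)
  refine ⟨sInf T, hcab, ?_, hleft⟩
  have hfc : ContinuousOn f (Icc a (sInf T)) := hf.mono (Icc_subset_Icc_right hcab.2)
  obtain ⟨d, hd, hfd⟩ := intermediate_value_Icc hcab.1 hfc ⟨ha, hyc⟩
  have hdT : d ∈ T := ⟨⟨hd.1, hd.2.trans hcab.2⟩, hfd.ge⟩
  have hdc : d = sInf T := le_antisymm hd.2 (csInf_le hTbdd hdT)
  rw [← hdc]
  exact hfd

/-- **Last passage from above.** If `f` is continuous on `[a,b]` and `f a ≤ y ≤ f b`, then there is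
`c ∈ [a,b]` with `f c = y` and `y < f x` for all `x ∈ (c,b]` (namely the supremum of the closed set
`{x ∈ [a,b] | f x ≤ y}`). [folklore] -/
theorem ivtNesting_exists_last_eq {f : ℝ → ℝ} {a b y : ℝ} (hab : a ≤ b)
    (hf : ContinuousOn f (Icc a b)) (ha : f a ≤ y) (hb : y ≤ f b) :
    ∃ c ∈ Icc a b, f c = y ∧ ∀ x ∈ Ioc c b, y < f x := by
  set T : Set ℝ := Icc a b ∩ f ⁻¹' (Iic y) with hT
  have hTc : IsClosed T := hf.preimage_isClosed_of_isClosed isClosed_Icc isClosed_Iic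
  have haT : a ∈ T := ⟨left_mem_Icc.2 hab, ha⟩
  have hTne : T.Nonempty := ⟨a, haT⟩
  have hTbdd : BddAbove T := ⟨b, fun x hx => hx.1.2⟩
  have hcT : sSup T ∈ T := hTc.csSup_mem hTne hTbdd
  have hcab : sSup T ∈ Icc a b := hcT.1
  have hyc : f (sSup T) ≤ y := hcT.2
  have hright : ∀ x ∈ Ioc (sSup T) b, y < f x := by
    intro x hx
    by_contra hxy
    have hxT : x ∈ T := ⟨⟨hcab.1.trans hx.1.le, hx.2⟩, not_lt.1 hxy⟩
    exact (not_le.2 hx.1) (le_csSup hTbdd hxT)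
  refine ⟨sSup T, hcab, ?_, hright⟩
  have hfc : ContinuousOn f (Icc (sSup T) b) := hf.mono (Icc_subset_Icc_left hcab.1)
  obtain ⟨d, hd, hfd⟩ := intermediate_value_Icc hcab.2 hfc ⟨hyc, hb⟩
  have hdT : d ∈ T := ⟨⟨hcab.1.trans hd.1, hd.2⟩, hfd.le⟩
  have hdc : d = sSup T := le_antisymm (le_csSup hTbdd hdT) hd.1
  rw [← hdc]
  exact hfd

/-- **One nesting step.** Under the window one-step hypotheses, an interval `[u,v] ⊆ [u₀,v₀]` on
which `β 0, …, β k` stay in `[lo,hi]`, with `β k u = lo` and `β k v = hi`, contains an interval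
`[u',v']` with the same property at level `k+1`: `v'` is the first passage of `β (k+1)` through
`hi` on `[u,v]` (note `β (k+1) u < lo < hi < β (k+1) v` by the exit hypotheses), and `u'` the last
passage through `lo` on `[u,v']`. [folklore] -/
theorem ivtNesting_step (β : ℕ → ℝ → ℝ) (lo hi u₀ v₀ : ℝ) (hlohi : lo < hi)
    (H : ∀ k : ℕ,
        ContinuousOn (β (k + 1)) {A ∈ Icc u₀ v₀ | ∀ j ≤ k, β j A ∈ Icc lo hi} ∧
        (∀ A ∈ Icc u₀ v₀, (∀ j ≤ k, β j A ∈ Icc lo hi) → β k A = lo → β (k + 1) A < lo) ∧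
        (∀ A ∈ Icc u₀ v₀, (∀ j ≤ k, β j A ∈ Icc lo hi) → β k A = hi → hi < β (k + 1) A))
    (k : ℕ) (u v : ℝ)
    (hP : u₀ ≤ u ∧ u ≤ v ∧ v ≤ v₀ ∧ β k u = lo ∧ β k v = hi ∧
      ∀ A ∈ Icc u v, ∀ j ≤ k, β j A ∈ Icc lo hi) :
    ∃ u' v' : ℝ, u ≤ u' ∧ v' ≤ v ∧
      (u₀ ≤ u' ∧ u' ≤ v' ∧ v' ≤ v₀ ∧ β (k + 1) u' = lo ∧ β (k + 1) v' = hi ∧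
        ∀ A ∈ Icc u' v', ∀ j ≤ k + 1, β j A ∈ Icc lo hi) := by
  obtain ⟨hu₀u, huv, hvv₀, hku, hkv, hwin⟩ := hP
  obtain ⟨hcont, hlow, hupp⟩ := H k
  have hsub : Icc u v ⊆ Icc u₀ v₀ := Icc_subset_Icc hu₀u hvv₀
  have hsubS : Icc u v ⊆ {A ∈ Icc u₀ v₀ | ∀ j ≤ k, β j A ∈ Icc lo hi} :=
    fun A hA => ⟨hsub hA, hwin A hA⟩
  have hf : ContinuousOn (β (k + 1)) (Icc u v) := hcont.mono hsubS
  have hu_mem : u ∈ Icc u v := left_mem_Icc.2 huv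
  have hv_mem : v ∈ Icc u v := right_mem_Icc.2 huv
  have hfu : β (k + 1) u < lo := hlow u (hsub hu_mem) (hwin u hu_mem) hku
  have hfv : hi < β (k + 1) v := hupp v (hsub hv_mem) (hwin v hv_mem) hkv
  -- first passage of `β (k+1)` through `hi` on `[u, v]`
  obtain ⟨v', hv'mem, hfv', hleft⟩ :=
    ivtNesting_exists_first_eq huv hf (hfu.le.trans hlohi.le) hfv.le
  -- last passage of `β (k+1)` through `lo` on `[u, v']`
  have hf' : ContinuousOn (β (k + 1)) (Icc u v') := hf.mono (Icc_subset_Icc_right hv'mem.2)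
  obtain ⟨u', hu'mem, hfu', hright⟩ :=
    ivtNesting_exists_last_eq hv'mem.1 hf' hfu.le (hlohi.le.trans hfv'.ge)
  refine ⟨u', v', hu'mem.1, hv'mem.2, hu₀u.trans hu'mem.1, hu'mem.2, hv'mem.2.trans hvv₀, hfu',
    hfv', ?_⟩
  intro A hA j hj
  have hAuv : A ∈ Icc u v := ⟨hu'mem.1.trans hA.1, hA.2.trans hv'mem.2⟩
  rcases hj.lt_or_eq with hj' | rfl
  · exact hwin A hAuv j (Nat.lt_succ_iff.1 hj')
  · refine ⟨?_, ?_⟩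
    · rcases eq_or_lt_of_le hA.1 with h | h
      · rw [← h]
        exact hfu'.ge
      · exact (hright A ⟨h, hA.2⟩).le
    · rcases eq_or_lt_of_le hA.2 with h | h
      · rw [h]
        exact hfv'.le
      · exact (hleft A ⟨hu'mem.1.trans hA.1, h⟩).le

/-- **Stub `ivtNesting` (nested-interval shooting).** Given real functions `β k`, a window
`[lo,hi]` with `lo < hi` and an interval `[u₀,v₀]` with `β 0 u₀ = lo`, `β 0 v₀ = hi`,
`β 0 ([u₀,v₀]) ⊆ [lo,hi]`, such that for every `k`, on the set where `β 0, …, β k` stay in the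
window, `β (k+1)` is continuous and exits the window at the edges (`β k = lo ⇒ β (k+1) < lo`,
`β k = hi ⇒ hi < β (k+1)`), there is an amplitude `A ∈ [u₀,v₀]` with `β k A ∈ [lo,hi]` for all
`k`. Proof: iterate `ivtNesting_step` to get nested intervals `[u k, v k]`, and take
`A := ⨆ k, u k`. [folklore] -/
theorem stub_ivtNesting :
    ∀ (β : ℕ → ℝ → ℝ) (lo hi u₀ v₀ : ℝ), lo < hi → u₀ ≤ v₀ →
      ContinuousOn (β 0) (Icc u₀ v₀) → β 0 u₀ = lo → β 0 v₀ = hi →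
      (∀ A ∈ Icc u₀ v₀, β 0 A ∈ Icc lo hi) →
      (∀ k : ℕ,
        ContinuousOn (β (k + 1)) {A ∈ Icc u₀ v₀ | ∀ j ≤ k, β j A ∈ Icc lo hi} ∧
        (∀ A ∈ Icc u₀ v₀, (∀ j ≤ k, β j A ∈ Icc lo hi) → β k A = lo → β (k + 1) A < lo) ∧
        (∀ A ∈ Icc u₀ v₀, (∀ j ≤ k, β j A ∈ Icc lo hi) → β k A = hi → hi < β (k + 1) A)) →
      ∃ A ∈ Icc u₀ v₀, ∀ k : ℕ, β k A ∈ Icc lo hi := by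
  intro β lo hi u₀ v₀ hlohi hu₀v₀ _hcont₀ h0u h0v hwin₀ H
  -- non-dependent choice functions for the nesting step
  have hstep : ∀ (k : ℕ) (u v : ℝ), ∃ u' v' : ℝ,
      (u₀ ≤ u ∧ u ≤ v ∧ v ≤ v₀ ∧ β k u = lo ∧ β k v = hi ∧
        ∀ A ∈ Icc u v, ∀ j ≤ k, β j A ∈ Icc lo hi) →
      u ≤ u' ∧ v' ≤ v ∧
      (u₀ ≤ u' ∧ u' ≤ v' ∧ v' ≤ v₀ ∧ β (k + 1) u' = lo ∧ β (k + 1) v' = hi ∧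
        ∀ A ∈ Icc u' v', ∀ j ≤ k + 1, β j A ∈ Icc lo hi) := by
    intro k u v
    by_cases hP : (u₀ ≤ u ∧ u ≤ v ∧ v ≤ v₀ ∧ β k u = lo ∧ β k v = hi ∧
        ∀ A ∈ Icc u v, ∀ j ≤ k, β j A ∈ Icc lo hi)
    · obtain ⟨u', v', h⟩ := ivtNesting_step β lo hi u₀ v₀ hlohi H k u v hP
      exact ⟨u', v', fun _ => h⟩
    · exact ⟨u, v, fun h => absurd h hP⟩
  choose fu fv hspec using hstep
  -- the two sequences of endpoints, defined by recursion along `ℕ`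
  obtain ⟨u, v, hu0, hv0, husucc, hvsucc⟩ : ∃ u v : ℕ → ℝ, u 0 = u₀ ∧ v 0 = v₀ ∧
      (∀ n, u (n + 1) = fu n (u n) (v n)) ∧ (∀ n, v (n + 1) = fv n (u n) (v n)) :=
    ⟨fun n => (Nat.rec (motive := fun _ => ℝ × ℝ) (u₀, v₀)
        (fun k p => (fu k p.1 p.2, fv k p.1 p.2)) n).1,
      fun n => (Nat.rec (motive := fun _ => ℝ × ℝ) (u₀, v₀)
        (fun k p => (fu k p.1 p.2, fv k p.1 p.2)) n).2,
      rfl, rfl, fun _ => rfl, fun _ => rfl⟩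
  -- the invariant, by induction
  have hinv : ∀ n, u₀ ≤ u n ∧ u n ≤ v n ∧ v n ≤ v₀ ∧ β n (u n) = lo ∧ β n (v n) = hi ∧
      ∀ A ∈ Icc (u n) (v n), ∀ j ≤ n, β j A ∈ Icc lo hi := by
    intro n
    induction n with
    | zero =>
      rw [hu0, hv0]
      refine ⟨le_rfl, hu₀v₀, le_rfl, h0u, h0v, ?_⟩
      intro A hA j hj
      rw [Nat.le_zero.1 hj]
      exact hwin₀ A hA
    | succ n ih =>
      rw [husucc n, hvsucc n]
      exact (hspec n (u n) (v n) ih).2.2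
  have hmono : Monotone u := by
    refine monotone_nat_of_le_succ fun n => ?_
    rw [husucc n]
    exact (hspec n (u n) (v n) (hinv n)).1
  have hanti : Antitone v := by
    refine antitone_nat_of_succ_le fun n => ?_
    rw [hvsucc n]
    exact (hspec n (u n) (v n) (hinv n)).2.1
  have huv : ∀ m n, u m ≤ v n := by
    intro m n
    rcases le_total m n with h | h
    · exact (hmono h).trans (hinv n).2.1
    · exact (hinv m).2.1.trans (hanti h)
  have hbdd : BddAbove (range u) := ⟨v 0, by
    rintro _ ⟨m, rfl⟩
    exact huv m 0⟩
  have hAu : ∀ n, u n ≤ ⨆ m, u m := fun n => le_ciSup hbdd n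
  have hAv : ∀ n, (⨆ m, u m) ≤ v n := fun n => ciSup_le fun m => huv m n
  refine ⟨⨆ m, u m, ⟨(hinv 0).1.trans (hAu 0), (hAv 0).trans (hinv 0).2.2.1⟩, fun k => ?_⟩
  exact (hinv k).2.2.2.2.2 _ ⟨hAu k, hAv k⟩ k le_rfl

end Summit.NavierStokesRegularity.NavierStokesRegularity.Theorems.PerpetualPumpAveragedTypeIBlowup

end
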